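import Summits.QuantumFields.YangMills.Theorems.BalabanUVNodesN27AtShellSplitOfRecord13CoPHVCut
import Summits.QuantumFields.YangMills.Theorems.BalabanUVNodesN20CoreEdgeAtShellSplitOfRecordTransfer
import Summits.QuantumFields.YangMills.Theorems.BalabanUVNodesN14BinderAtSpineReadingOfRecord13CoPHV
import Summits.QuantumFields.YangMills.Theorems.BalabanUVNodesN20CoreEdgeAtShellSplitOfRecordFibre

/-!
# BalabanUVNodes ∕ N27 = binder B5 AT THE RECORD — **EVERY K5 SLOT IN ITS PRODUCER'S DEEPEST LANDED CURRENCY AT THE v3 PIN**: B5 on the live line at the per-tuple-cut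
# physical-volume spine reading of record WITH dag-n21-d's SHELL SPLIT OF RECORD `shellSplitOfRecord₁₃At N K₀ ρA ρB`, where N21 ⟸ the per-top-cube (M1) rows (dag-n21-d p593341),
# **N19′ ⟸ THE LOWERED-THRESHOLD TERM SANDWICH** (dag-n20-w3 FILE B `…N20CoreEdgeAtShellSplitOfRecordTransfer` §4 ★★★ `core_crOfRecord₁₃VAt_shellSplit_of_loweredTerm_liveSel`, landed
# 02:00Z 2026-08-28) or, in §2, ⟸ dag-n14-w2's (V) VACUUM BRACKET + node U3's TV READ-OUT SENTENCE (`…N14BinderAtSpineReadingOfRecord13CoPHV`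
# `core_crOfRecord₁₃VAt_shellSplitOfRecord_of_coreZero_of_tv`, landed 02:05Z), N27x a THEOREM, (H-U) ∕ `0 ≤ ζ` THEOREMS, N20 a keyed witness at the tuple's own cut depth — the K5
# analogue of this lineage's W
# `…N27KeyedRatesAtAdmReadingOfRecord13CoPHProducers` (p591658, the K4 half from producers)
# (cell `pub-ymgap`, HUMAN RULING D-0062 Track A, R134 seat `pub-ymgap-dag-n27-c` (N27 B5 composite, s2) gen 12, HOME trigger (t2) «a producer face at the spine reading in a NEW currency
# NOT knitted by its declarer»; K3⁷ `SpineGivenEndpointR13SepCoPH` = stmt-QuantumFields-20544 (plan g81 skeleton v3 02f6f498332fdbee), `--kind proof --supports 20544 --as helper`;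
# COUNT-NEUTRAL; THEOREMS ONLY, 0 `def`, 0 `sorry`; `N`-generic, `K₀`-generic, regime-generic, NO Theses import — the item face is leaf `…N27SpineGivenEndpointR13SepCoPHShellSplitOfRecordVProducers`)

WHAT IS KERNEL-CHECKED ([bookkeeping]; ONE application of X §1 with the producer's theorem in the N19′ slot, per tuple at `jcut := jc F θ hP g₀ os`; §2 ∕ §3 ∕ §4 are the same with
dag-n14-w2's (V)+TV face, dag-n20-w3's policy-free FIBRE face, and the fibre face at the ZERO CUT with N20 discharged — see the section docstrings).
★★★ §1 `spine_rec13CCoPHOn_live_at_shellSplitOfRecord₁₃VAt_cut_of_keyedFacesP_cubeAC_loweredTerm` — B5 at the record class of `G ∧ LiveSel` from, binder by binder: the one law `hζm`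
(`ZetaMeasurable θ.ζ`); N20 as a keyed `RelWeightBound` witness (`h20`); **N21's rows** (dag-n21-d): width signs `hρA hρB`, per tuple `hM1` (`∃ DA DB ≥ 0`, `Summable (D_K·ρ_K)`,
per-(run, K, |t| ≤ 1, top cube) (M1)); the rates `P` at `rr` (`hrates`); **N19′'s rows** (dag-n20-w3, VERBATIM binder shapes; their `hM : 0 < θ.τ9.M` is `Admissible`'s Stage-9 row `1 ≤ M`, supplied as `hθ.toStage9.2.2.2`): the flow hypothesis `hR` (`RAgree` of
the two runs' histories of record at every comparison), the policy letters `hj : 1 ≤ jc … K ≤ K₀ + K` (the term road EXCLUDES the zero cut), the lowered widths' signs `hερ : 0 ≤ ε·ρ`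
per run, and `h19` = GIVEN THE RATES `P`, a summable `δ` and, per `K`, ONE constant `c` with the LOWERED-THRESHOLD SANDWICH «the (2.18) term of `s` at cutoff `K₀ + K` and of
`liftSeq s` at `K₀ + K + 1`, both re-tested at `ε_k(1 − ρ)`, agree up to `e^{c ∓ (2L^m)⁴·δ_K}`» on the run-A indices small-field at every level `1 ≤ j ≤ jc … K` — N19's NE7 core AT THE
RECORD, term vs lifted term (NOT PRINTED for d = 4, NOT proved; displayed) ⇒ `Spine` at `IsRecordOfRecord₁₃CCoPHOn F N (G ∧ LiveSel)`.
Consumed BY NAME: X (gen 12) and through it UC, dag-n21-d p593341, node00-def-K0c `localBgMeasurable`, dag-n20-w2 `zeta_nonneg_of_provisos₁₃CoPH`; dag-n20-w3 FILE B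
`core_crOfRecord₁₃VAt_shellSplit_of_loweredTerm_liveSel` (its `hU` supplied by K0c's theorem); dag-n14-w2 `core_crOfRecord₁₃VAt_shellSplitOfRecord_of_coreZero_of_tv` (§2; its `hζ0`
supplied by n20-w2's theorem); node 00's `RAgree ∕ liftSeq ∕ chiSeqOfRecordAt ∕ epsOfRecord ∕ dressedSlotsOfDatum₉`.  Nothing landed is edited or re-declared.

HONEST FRAMING.  COMPOSITE-node bookkeeping BY NAME; NO estimate of Bałaban's asserted, used or proved; the sandwich (N19's NE7 core at the record) and (M1) per top cube (N21's) are the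
producers' DISPLAYED estimates, NOT PRINTED for d = 4 and NOT proved, carried VERBATIM as hypotheses; `RAgree`, `0 < M`, the policy∕width letters are LETTERS∕located consistency
rows of the producers (their (α) READING banners apply verbatim: NC-NE7b-α unruled; A6 zero-width junk instance); the rates `P` and the N20 witness are hypotheses; every antecedent
inhabited for no family today (K0⁷ OPEN); `jc ρA ρB` FREE (the prover's dials, plan ruling (a)); nothing of Bałaban's instantiated; N19 ∕ N20 ∕ N21 ∕ N27 NOT discharged (the chair
books, R417); K3⁷ NOT claimed; skeleton v3 untouched; counts UNMOVED (typed 28∕28 · discharged 5∕27, A 5∕28); one finite four-torus programme at fixed `ε` — NOT ℝ⁴, NOT infinite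
volume, NOT OS, NOT a mass gap, NOT Clay.  No decl below carries a cite tag.
-/

set_option autoImplicit false

noncomputable section

namespace Summit.QuantumFields.YangMills.Theorems.BalabanUVNodesN27SpineRecord

open scoped BigOperators
open Finset MeasureTheory
open Literature.MathematicalPhysics.QuantumFieldTheory.Balaban1983to89
open Literature.MathematicalPhysics.QuantumFieldTheory.Balaban1983to89.T4Continuum
open Literature.MathematicalPhysics.QuantumFieldTheory.Balaban1983to89.Node00
open T4WeightBudget (RelWeightBound)
open T4IndicatorShell (ShellWeightBound)
open T4ContinuumYM4Torus (ForSmallCouplings)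
open Summit.QuantumFields.BalabanUV.T4Continuum.Spine
open YMDAG.UVSplit
open Summit.QuantumFields.YangMills.BalabanUVNodes.N19TargetClassWeightsE1Keyed
open Summit.QuantumFields.YangMills.BalabanUVNodes.N16HolderDefs (S_N16Holder)
open Summit.QuantumFields.YangMills.BalabanUVNodes.SpineRatesHolder (RatesHolderAt)
open Summit.QuantumFields.YangMills.Theorems.N21ShellSplitOfRecord13CoPH (WidthLetter₁₃CoPH shellSplitOfRecord₁₃At shellA₁₃ shellB₁₃ shellPieceOfDatum₉ cubeWeightOfDatum₉)
open Summit.QuantumFields.YangMills.BalabanUVNodes.N20CoreEdgeAtShellSplitTransfer (core_crOfRecord₁₃VAt_shellSplit_of_loweredTerm_liveSel)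
open Summit.QuantumFields.YangMills.BalabanUVNodes.N21KeyedShellWeightShellZero (zeta_nonneg_of_provisos₁₃CoPH)
open Summit.QuantumFields.YangMills.BalabanUVNodes.N20CoreEdgeAtShellSplitFibre (core_crOfRecord₁₃VAt_shellSplit_of_loweredFibre_liveSel)
open Summit.QuantumFields.YangMills.BalabanUVNodes.N20KeyedRelWeightCutZero (relWeightBound_carriers₁₃_cutZero)
open YMDAG.N14.AtSpineReading13CoPH (classMeasA₁₃ classMeasB₁₃)
open YMDAG.N14.AtSpineReading13CoPH.Shell (shellMeasA₁₃ shellMeasB₁₃)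

variable {N : ℕ} [NeZero N] (K₀ : ℕ)
  (jc : (F : T4Family) → (θ : Stage13HParams F N) → θ.Provisos₁₃CoPH F N → (ℕ → ℝ) → List (ULoop F) → ℕ → ℕ)
  (ρA ρB : WidthLetter₁₃CoPH N) (G : (F : T4Family) → Stage13HParams F N → Prop)
  (rr : (F : T4Family) → (θ : Stage13HParams F N) → θ.Provisos₁₃CoPH F N → (ℕ → ℝ) → List (ULoop F) → RateCarriers N)
  (P : ∀ {F : T4Family}, Datum F N → RateCarriers N → Prop)

/-- ★★★ **B5 ON THE LIVE LINE OF A REGIME `G` AT THE v3 PIN WITH THE SHELL SPLIT OF RECORD — N20 a keyed witness, N21 ⟸ dag-n21-d's (M1) ROWS, N19′ ⟸ dag-n20-w3's LOWERED-THRESHOLD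
TERM SANDWICH, N27x ∕ (H-U) ∕ `0 ≤ ζ` THEOREMS** (X §1 `spine_rec13CCoPHOn_live_at_shellSplitOfRecord₁₃VAt_cut_of_keyedFacesP_cubeAC` with `h19 :=` dag-n20-w3's
`core_crOfRecord₁₃VAt_shellSplit_of_loweredTerm_liveSel` per tuple at `jcut := jc F θ hP g₀ os`, `hU :=` K0c's `localBgMeasurable`, `hsel` read off the regime).  Every producer row is a
DISPLAYED HYPOTHESIS (0∕1 today); the sandwich and (M1) are NOT PRINTED for d = 4 and NOT proved. [bookkeeping] -/
theorem spine_rec13CCoPHOn_live_at_shellSplitOfRecord₁₃VAt_cut_of_keyedFacesP_cubeAC_loweredTerm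
    (hζm : ∀ (F : T4Family) (θ : Stage13HParams F N), θ.Provisos₁₃CoPH F N →
      (G F θ ∧ θ.ppSel = ppSelLiveOfRecord F N θ.ν θ.τ9 (EOfRecord₁₃ F N θ.toStage13Params) (wOfRecord₉ F N θ.toStage9Params)) → θ.Admissible F N → ZetaMeasurable F N θ.ζ)
    (h20 : ∀ (F : T4Family) (θ : Stage13HParams F N) (hP : θ.Provisos₁₃CoPH F N),
      (G F θ ∧ θ.ppSel = ppSelLiveOfRecord F N θ.ν θ.τ9 (EOfRecord₁₃ F N θ.toStage13Params) (wOfRecord₉ F N θ.toStage9Params)) → θ.Admissible F N →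
        ∀ (g₀ : ℕ → ℝ) (os : List (ULoop F)),
          ∃ W : ℕ → ℝ, RelWeightBound 1 (classSet₁₃ θ K₀ g₀) (weightA₁₃ θ hP K₀ g₀ os) (weightB₁₃ θ hP K₀ g₀ os) (badClass₁₃ θ K₀ g₀ (jc F θ hP g₀ os)) W)
    (hρA : ∀ (F : T4Family) (θ : Stage13HParams F N) (hP : θ.Provisos₁₃CoPH F N),
      (G F θ ∧ θ.ppSel = ppSelLiveOfRecord F N θ.ν θ.τ9 (EOfRecord₁₃ F N θ.toStage13Params) (wOfRecord₉ F N θ.toStage9Params)) → θ.Admissible F N →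
        ∀ (g₀ : ℕ → ℝ) (os : List (ULoop F)) (K : ℕ), 0 ≤ ρA F θ hP g₀ os K)
    (hρB : ∀ (F : T4Family) (θ : Stage13HParams F N) (hP : θ.Provisos₁₃CoPH F N),
      (G F θ ∧ θ.ppSel = ppSelLiveOfRecord F N θ.ν θ.τ9 (EOfRecord₁₃ F N θ.toStage13Params) (wOfRecord₉ F N θ.toStage9Params)) → θ.Admissible F N →
        ∀ (g₀ : ℕ → ℝ) (os : List (ULoop F)) (K : ℕ), 0 ≤ ρB F θ hP g₀ os K)
    (hM1 : ∀ (F : T4Family) (θ : Stage13HParams F N) (hP : θ.Provisos₁₃CoPH F N),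
      (G F θ ∧ θ.ppSel = ppSelLiveOfRecord F N θ.ν θ.τ9 (EOfRecord₁₃ F N θ.toStage13Params) (wOfRecord₉ F N θ.toStage9Params)) → θ.Admissible F N →
        ∀ (g₀ : ℕ → ℝ) (os : List (ULoop F)), ∃ DA DB : ℕ → ℝ, (∀ K, 0 ≤ DA K) ∧ (∀ K, 0 ≤ DB K) ∧
          Summable (fun K => DA K * ρA F θ hP g₀ os K) ∧ Summable (fun K => DB K * ρB F θ hP g₀ os K) ∧
          (∀ (K : ℕ) (t : ℝ), |t| ≤ 1 →
            ∀ a : ↥(cubeIndices (F.P (K₀ + K)) (cubeSide (F.P (K₀ + K)).L θ.ν.M₂ (RkOfRecord (F.P (K₀ + K)).L θ.ν.r (histA₁₃ θ K₀ g₀ K (K₀ + K))) (K₀ + K))),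
              ∑ s, shellPieceOfDatum₉ F N θ.toStage9Params (datumOfRecord₁₃CoPH F N θ hP) g₀ os (runA₁₃ F K₀ g₀ K) (histA₁₃ θ K₀ g₀ K) (K₀ + K)
                  (ρA F θ hP g₀ os K) t a s ≤
                (DA K * ρA F θ hP g₀ os K) *
                  ∑ s, cubeWeightOfDatum₉ F N θ.toStage9Params (datumOfRecord₁₃CoPH F N θ hP) g₀ os (runA₁₃ F K₀ g₀ K) (histA₁₃ θ K₀ g₀ K) (K₀ + K) t a s) ∧
          (∀ (K : ℕ) (t : ℝ), |t| ≤ 1 →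
            ∀ a : ↥(cubeIndices (F.P (K₀ + K + 1)) (cubeSide (F.P (K₀ + K + 1)).L θ.ν.M₂
                (RkOfRecord (F.P (K₀ + K + 1)).L θ.ν.r (histB₁₃ θ K₀ g₀ K (K₀ + K + 1))) (K₀ + K + 1))),
              ∑ s', shellPieceOfDatum₉ F N θ.toStage9Params (datumOfRecord₁₃CoPH F N θ hP) g₀ os (runB₁₃ F K₀ g₀ K) (histB₁₃ θ K₀ g₀ K) (K₀ + K + 1)
                  (ρB F θ hP g₀ os K) t a s' ≤
                (DB K * ρB F θ hP g₀ os K) *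
                  ∑ s', cubeWeightOfDatum₉ F N θ.toStage9Params (datumOfRecord₁₃CoPH F N θ hP) g₀ os (runB₁₃ F K₀ g₀ K) (histB₁₃ θ K₀ g₀ K) (K₀ + K + 1) t a s'))
    (hrates : ∀ (F : T4Family) (θ : Stage13HParams F N) (hP : θ.Provisos₁₃CoPH F N),
      (G F θ ∧ θ.ppSel = ppSelLiveOfRecord F N θ.ν θ.τ9 (EOfRecord₁₃ F N θ.toStage13Params) (wOfRecord₉ F N θ.toStage9Params)) → θ.Admissible F N →
        ∀ (g₀ : ℕ → ℝ) (os : List (ULoop F)), P (datumOfRecord₁₃CoPH F N θ hP) (rr F θ hP g₀ os))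
    (hR : ∀ (F : T4Family) (θ : Stage13HParams F N) (hP : θ.Provisos₁₃CoPH F N), (G F θ ∧ θ.ppSel = ppSelLiveOfRecord F N θ.ν θ.τ9 (EOfRecord₁₃ F N θ.toStage13Params) (wOfRecord₉ F N θ.toStage9Params)) → θ.Admissible F N →
      ∀ (g₀ : ℕ → ℝ) (K : ℕ), RAgree F θ.ν (histA₁₃ θ K₀ g₀ K) (histB₁₃ θ K₀ g₀ K) (K₀ + K))
    (hj : ∀ (F : T4Family) (θ : Stage13HParams F N) (hP : θ.Provisos₁₃CoPH F N), (G F θ ∧ θ.ppSel = ppSelLiveOfRecord F N θ.ν θ.τ9 (EOfRecord₁₃ F N θ.toStage13Params) (wOfRecord₉ F N θ.toStage9Params)) → θ.Admissible F N →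
      ∀ (g₀ : ℕ → ℝ) (os : List (ULoop F)) (K : ℕ), 1 ≤ jc F θ hP g₀ os K ∧ jc F θ hP g₀ os K ≤ K₀ + K)
    (hερ : ∀ (F : T4Family) (θ : Stage13HParams F N) (hP : θ.Provisos₁₃CoPH F N), (G F θ ∧ θ.ppSel = ppSelLiveOfRecord F N θ.ν θ.τ9 (EOfRecord₁₃ F N θ.toStage13Params) (wOfRecord₉ F N θ.toStage9Params)) → θ.Admissible F N →
      ∀ (g₀ : ℕ → ℝ) (os : List (ULoop F)) (K : ℕ), 0 ≤ epsOfRecord θ.ν (histA₁₃ θ K₀ g₀ K) (K₀ + K) * ρA F θ hP g₀ os K ∧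
        0 ≤ epsOfRecord θ.ν (histB₁₃ θ K₀ g₀ K) (K₀ + K + 1) * ρB F θ hP g₀ os K)
    (h19 : ∀ (F : T4Family) (θ : Stage13HParams F N) (hP : θ.Provisos₁₃CoPH F N) (hRg : (G F θ ∧ θ.ppSel = ppSelLiveOfRecord F N θ.ν θ.τ9 (EOfRecord₁₃ F N θ.toStage13Params) (wOfRecord₉ F N θ.toStage9Params))) (hθ : θ.Admissible F N)
      (g₀ : ℕ → ℝ) (os : List (ULoop F)), P (datumOfRecord₁₃CoPH F N θ hP) (rr F θ hP g₀ os) →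
        ∃ δ : ℕ → ℝ, Summable δ ∧ ∀ K : ℕ, ∃ c : ℝ, ∀ t : ℝ, |t| ≤ 1 → ∀ s : SeqOfRecord F θ.ν θ.τ9.M (histA₁₃ θ K₀ g₀ K) (K₀ + K) (K₀ + K),
          (∀ j, 1 ≤ j → j ≤ jc F θ hP g₀ os K → s.Λ j = Set.univ) →
          Real.exp (c - F.side ^ 4 * δ K) *
                (∫ V, chiSeqOfRecordAt F N θ.ν θ.τ9.M (histA₁₃ θ K₀ g₀ K) (K₀ + K) (K₀ + K)
                    (epsOfRecord θ.ν (histA₁₃ θ K₀ g₀ K) (K₀ + K) * (1 - ρA F θ hP g₀ os K)) s V *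
                  dressedSlotsOfDatum₉ F N θ.toStage9Params (datumOfRecord₁₃CoPH F N θ hP) g₀ os t (runA₁₃ F K₀ g₀ K) (histA₁₃ θ K₀ g₀ K) (K₀ + K) s V
                  ∂fieldMeasure (F.P (K₀ + K)) (K₀ + K) (Node00.SU N))
              ≤ (∫ V, chiSeqOfRecordAt F N θ.ν θ.τ9.M (histB₁₃ θ K₀ g₀ K) (K₀ + K + 1) (K₀ + K + 1)
                    (epsOfRecord θ.ν (histB₁₃ θ K₀ g₀ K) (K₀ + K + 1) * (1 - ρB F θ hP g₀ os K)) (liftSeq F θ.ν hθ.toStage9.2.2.2 (hR F θ hP hRg hθ g₀ K) s) V *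
                  dressedSlotsOfDatum₉ F N θ.toStage9Params (datumOfRecord₁₃CoPH F N θ hP) g₀ os t (runB₁₃ F K₀ g₀ K) (histB₁₃ θ K₀ g₀ K) (K₀ + K + 1)
                    (liftSeq F θ.ν hθ.toStage9.2.2.2 (hR F θ hP hRg hθ g₀ K) s) V
                  ∂fieldMeasure (F.P (K₀ + K + 1)) (K₀ + K + 1) (Node00.SU N)) ∧
            (∫ V, chiSeqOfRecordAt F N θ.ν θ.τ9.M (histB₁₃ θ K₀ g₀ K) (K₀ + K + 1) (K₀ + K + 1)
                    (epsOfRecord θ.ν (histB₁₃ θ K₀ g₀ K) (K₀ + K + 1) * (1 - ρB F θ hP g₀ os K)) (liftSeq F θ.ν hθ.toStage9.2.2.2 (hR F θ hP hRg hθ g₀ K) s) V *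
                  dressedSlotsOfDatum₉ F N θ.toStage9Params (datumOfRecord₁₃CoPH F N θ hP) g₀ os t (runB₁₃ F K₀ g₀ K) (histB₁₃ θ K₀ g₀ K) (K₀ + K + 1)
                    (liftSeq F θ.ν hθ.toStage9.2.2.2 (hR F θ hP hRg hθ g₀ K) s) V
                  ∂fieldMeasure (F.P (K₀ + K + 1)) (K₀ + K + 1) (Node00.SU N))
              ≤ Real.exp (c + F.side ^ 4 * δ K) *
                (∫ V, chiSeqOfRecordAt F N θ.ν θ.τ9.M (histA₁₃ θ K₀ g₀ K) (K₀ + K) (K₀ + K)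
                    (epsOfRecord θ.ν (histA₁₃ θ K₀ g₀ K) (K₀ + K) * (1 - ρA F θ hP g₀ os K)) s V *
                  dressedSlotsOfDatum₉ F N θ.toStage9Params (datumOfRecord₁₃CoPH F N θ hP) g₀ os t (runA₁₃ F K₀ g₀ K) (histA₁₃ θ K₀ g₀ K) (K₀ + K) s V
                  ∂fieldMeasure (F.P (K₀ + K)) (K₀ + K) (Node00.SU N))) :
    Spine (N := N) fun F D w => Node00.IsRecordOfRecord₁₃CCoPHOn F N
      (fun F θ => G F θ ∧ θ.ppSel = ppSelLiveOfRecord F N θ.ν θ.τ9 (EOfRecord₁₃ F N θ.toStage13Params) (wOfRecord₉ F N θ.toStage9Params)) D w :=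
  spine_rec13CCoPHOn_live_at_shellSplitOfRecord₁₃VAt_cut_of_keyedFacesP_cubeAC K₀ jc ρA ρB G rr P hζm h20 hρA hρB hM1 hrates
    (fun F θ hP hRg hθ g₀ os hPr => by
      letI : DecidableEq (Σ K, SiteSeqKey F (K₀ + K)) := Classical.decEq _
      obtain ⟨δ, hδ, hlow⟩ := h19 F θ hP hRg hθ g₀ os hPr
      have h := core_crOfRecord₁₃VAt_shellSplit_of_loweredTerm_liveSel θ hP K₀ g₀ os hθ.toStage9.2.2.2 (hR F θ hP hRg hθ g₀) (jc F θ hP g₀ os)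
        (fun K => (hj F θ hP hRg hθ g₀ os K).1) (fun K => (hj F θ hP hRg hθ g₀ os K).2) ρA ρB hδ _ hRg.2 (localBgMeasurable F N θ.ν) (hζm F θ hP hRg hθ)
        (fun K => (hερ F θ hP hRg hθ g₀ os K).1) (fun K => (hερ F θ hP hRg hθ g₀ os K).2) hlow
      exact ⟨_, h.1, h.2⟩)

/-! ## §2 N19′ in dag-n14-w2's (V) + U3-TV currency at the same pin (p≈02:05Z `…N14BinderAtSpineReadingOfRecord13CoPHV`) -/

/-- ★★★ **B5 ON THE LIVE LINE OF A REGIME `G` AT THE v3 PIN WITH THE SHELL SPLIT OF RECORD — N20 a keyed witness, N21 ⟸ dag-n21-d's (M1) ROWS, N19′ ⟸ dag-n14-w2's (V) VACUUM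
BRACKET + node U3's TV READ-OUT SENTENCE, N27x ∕ (H-U) ∕ `0 ≤ ζ` THEOREMS** (X §1 with `h19 :=` dag-n14-w2's `core_crOfRecord₁₃VAt_shellSplitOfRecord_of_coreZero_of_tv` per tuple at
`jcut := jc F θ hP g₀ os`, `hζ0 := zeta_nonneg_of_provisos₁₃CoPH F θ hP`, `hsel` read off the regime): displayed per tuple GIVEN THE RATES `P` — a summable `δ₀` with (V) §N19 s1's
`NE7.Core 1 (F.side ^ 4)` bracket on the VACUUM (`t = 0`) shell-free class weights of record at the split of record, and a summable `ρ` with (I) node U3's read-out sentence in TV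
currency for the SHELL-FREE class laws of record `classMeasA₁₃ − shellMeasA₁₃` ∕ `classMeasB₁₃ − shellMeasB₁₃` pushed to the unit lattice (dag-n14-w2's binder text VERBATIM) — both
HYPOTHESIS SHAPES produced by nobody (UNPRINTED two-run statements for d = 4), NOT proved. [bookkeeping] -/
theorem spine_rec13CCoPHOn_live_at_shellSplitOfRecord₁₃VAt_cut_of_keyedFacesP_cubeAC_vacuumTV
    (hζm : ∀ (F : T4Family) (θ : Stage13HParams F N), θ.Provisos₁₃CoPH F N →
      (G F θ ∧ θ.ppSel = ppSelLiveOfRecord F N θ.ν θ.τ9 (EOfRecord₁₃ F N θ.toStage13Params) (wOfRecord₉ F N θ.toStage9Params)) → θ.Admissible F N → ZetaMeasurable F N θ.ζ)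
    (h20 : ∀ (F : T4Family) (θ : Stage13HParams F N) (hP : θ.Provisos₁₃CoPH F N),
      (G F θ ∧ θ.ppSel = ppSelLiveOfRecord F N θ.ν θ.τ9 (EOfRecord₁₃ F N θ.toStage13Params) (wOfRecord₉ F N θ.toStage9Params)) → θ.Admissible F N →
        ∀ (g₀ : ℕ → ℝ) (os : List (ULoop F)),
          ∃ W : ℕ → ℝ, RelWeightBound 1 (classSet₁₃ θ K₀ g₀) (weightA₁₃ θ hP K₀ g₀ os) (weightB₁₃ θ hP K₀ g₀ os) (badClass₁₃ θ K₀ g₀ (jc F θ hP g₀ os)) W)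
    (hρA : ∀ (F : T4Family) (θ : Stage13HParams F N) (hP : θ.Provisos₁₃CoPH F N),
      (G F θ ∧ θ.ppSel = ppSelLiveOfRecord F N θ.ν θ.τ9 (EOfRecord₁₃ F N θ.toStage13Params) (wOfRecord₉ F N θ.toStage9Params)) → θ.Admissible F N →
        ∀ (g₀ : ℕ → ℝ) (os : List (ULoop F)) (K : ℕ), 0 ≤ ρA F θ hP g₀ os K)
    (hρB : ∀ (F : T4Family) (θ : Stage13HParams F N) (hP : θ.Provisos₁₃CoPH F N),
      (G F θ ∧ θ.ppSel = ppSelLiveOfRecord F N θ.ν θ.τ9 (EOfRecord₁₃ F N θ.toStage13Params) (wOfRecord₉ F N θ.toStage9Params)) → θ.Admissible F N →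
        ∀ (g₀ : ℕ → ℝ) (os : List (ULoop F)) (K : ℕ), 0 ≤ ρB F θ hP g₀ os K)
    (hM1 : ∀ (F : T4Family) (θ : Stage13HParams F N) (hP : θ.Provisos₁₃CoPH F N),
      (G F θ ∧ θ.ppSel = ppSelLiveOfRecord F N θ.ν θ.τ9 (EOfRecord₁₃ F N θ.toStage13Params) (wOfRecord₉ F N θ.toStage9Params)) → θ.Admissible F N →
        ∀ (g₀ : ℕ → ℝ) (os : List (ULoop F)), ∃ DA DB : ℕ → ℝ, (∀ K, 0 ≤ DA K) ∧ (∀ K, 0 ≤ DB K) ∧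
          Summable (fun K => DA K * ρA F θ hP g₀ os K) ∧ Summable (fun K => DB K * ρB F θ hP g₀ os K) ∧
          (∀ (K : ℕ) (t : ℝ), |t| ≤ 1 →
            ∀ a : ↥(cubeIndices (F.P (K₀ + K)) (cubeSide (F.P (K₀ + K)).L θ.ν.M₂ (RkOfRecord (F.P (K₀ + K)).L θ.ν.r (histA₁₃ θ K₀ g₀ K (K₀ + K))) (K₀ + K))),
              ∑ s, shellPieceOfDatum₉ F N θ.toStage9Params (datumOfRecord₁₃CoPH F N θ hP) g₀ os (runA₁₃ F K₀ g₀ K) (histA₁₃ θ K₀ g₀ K) (K₀ + K)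
                  (ρA F θ hP g₀ os K) t a s ≤
                (DA K * ρA F θ hP g₀ os K) *
                  ∑ s, cubeWeightOfDatum₉ F N θ.toStage9Params (datumOfRecord₁₃CoPH F N θ hP) g₀ os (runA₁₃ F K₀ g₀ K) (histA₁₃ θ K₀ g₀ K) (K₀ + K) t a s) ∧
          (∀ (K : ℕ) (t : ℝ), |t| ≤ 1 →
            ∀ a : ↥(cubeIndices (F.P (K₀ + K + 1)) (cubeSide (F.P (K₀ + K + 1)).L θ.ν.M₂
                (RkOfRecord (F.P (K₀ + K + 1)).L θ.ν.r (histB₁₃ θ K₀ g₀ K (K₀ + K + 1))) (K₀ + K + 1))),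
              ∑ s', shellPieceOfDatum₉ F N θ.toStage9Params (datumOfRecord₁₃CoPH F N θ hP) g₀ os (runB₁₃ F K₀ g₀ K) (histB₁₃ θ K₀ g₀ K) (K₀ + K + 1)
                  (ρB F θ hP g₀ os K) t a s' ≤
                (DB K * ρB F θ hP g₀ os K) *
                  ∑ s', cubeWeightOfDatum₉ F N θ.toStage9Params (datumOfRecord₁₃CoPH F N θ hP) g₀ os (runB₁₃ F K₀ g₀ K) (histB₁₃ θ K₀ g₀ K) (K₀ + K + 1) t a s'))
    (hrates : ∀ (F : T4Family) (θ : Stage13HParams F N) (hP : θ.Provisos₁₃CoPH F N),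
      (G F θ ∧ θ.ppSel = ppSelLiveOfRecord F N θ.ν θ.τ9 (EOfRecord₁₃ F N θ.toStage13Params) (wOfRecord₉ F N θ.toStage9Params)) → θ.Admissible F N →
        ∀ (g₀ : ℕ → ℝ) (os : List (ULoop F)), P (datumOfRecord₁₃CoPH F N θ hP) (rr F θ hP g₀ os))
    (h19 : ∀ (F : T4Family) (θ : Stage13HParams F N) (hP : θ.Provisos₁₃CoPH F N), (G F θ ∧ θ.ppSel = ppSelLiveOfRecord F N θ.ν θ.τ9 (EOfRecord₁₃ F N θ.toStage13Params) (wOfRecord₉ F N θ.toStage9Params)) → θ.Admissible F N →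
      ∀ (g₀ : ℕ → ℝ) (os : List (ULoop F)), P (datumOfRecord₁₃CoPH F N θ hP) (rr F θ hP g₀ os) → letI : DecidableEq (Σ K, SiteSeqKey F (K₀ + K)) := Classical.decEq _
        ∃ δ₀ ρ : ℕ → ℝ, Summable δ₀ ∧ Summable ρ ∧
          NE7.Core 1 ((F.side : ℝ) ^ 4) (classSet₁₃ θ K₀ g₀) (badClass₁₃ θ K₀ g₀ (jc F θ hP g₀ os))
            (fun K _ x => weightA₁₃ θ hP K₀ g₀ os K 0 x - shellA₁₃ θ hP K₀ g₀ os (ρA F θ hP g₀ os) K 0 x)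
            (fun K _ x => weightB₁₃ θ hP K₀ g₀ os K 0 x - shellB₁₃ θ hP K₀ g₀ os (ρB F θ hP g₀ os) K 0 x) δ₀ ∧
          (∀ (K : ℕ) (t : ℝ), |t| ≤ 1 → ∀ x ∈ classSet₁₃ θ K₀ g₀ K \ badClass₁₃ θ K₀ g₀ (jc F θ hP g₀ os) K t, ∀ S : Set (GaugeField (F.P 0) 0 (Node00.SU N)), MeasurableSet S →
            |((classMeasB₁₃ θ K₀ g₀ K x - shellMeasB₁₃ θ K₀ g₀ (ρB F θ hP g₀ os) K x).map
                      ((T4RunLadder.unitFactorisation (datumOfRecord₁₃CoPH F N θ hP) (isPrintedAveraged_datumOfRecord₁₃CoPH F N θ hP).avgMeasurable g₀).A (K₀ + K + 1))).real S /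
                    ((classMeasB₁₃ θ K₀ g₀ K x - shellMeasB₁₃ θ K₀ g₀ (ρB F θ hP g₀ os) K x).map
                      ((T4RunLadder.unitFactorisation (datumOfRecord₁₃CoPH F N θ hP) (isPrintedAveraged_datumOfRecord₁₃CoPH F N θ hP).avgMeasurable g₀).A (K₀ + K + 1))).real Set.univ -
                  ((classMeasA₁₃ θ K₀ g₀ K x - shellMeasA₁₃ θ K₀ g₀ (ρA F θ hP g₀ os) K x).map
                      ((T4RunLadder.unitFactorisation (datumOfRecord₁₃CoPH F N θ hP) (isPrintedAveraged_datumOfRecord₁₃CoPH F N θ hP).avgMeasurable g₀).A (K₀ + K))).real S /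
                    ((classMeasA₁₃ θ K₀ g₀ K x - shellMeasA₁₃ θ K₀ g₀ (ρA F θ hP g₀ os) K x).map
                      ((T4RunLadder.unitFactorisation (datumOfRecord₁₃CoPH F N θ hP) (isPrintedAveraged_datumOfRecord₁₃CoPH F N θ hP).avgMeasurable g₀).A (K₀ + K))).real Set.univ| ≤
                  ρ K)) :
    Spine (N := N) fun F D w => Node00.IsRecordOfRecord₁₃CCoPHOn F N
      (fun F θ => G F θ ∧ θ.ppSel = ppSelLiveOfRecord F N θ.ν θ.τ9 (EOfRecord₁₃ F N θ.toStage13Params) (wOfRecord₉ F N θ.toStage9Params)) D w :=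
  spine_rec13CCoPHOn_live_at_shellSplitOfRecord₁₃VAt_cut_of_keyedFacesP_cubeAC K₀ jc ρA ρB G rr P hζm h20 hρA hρB hM1 hrates
    (fun F θ hP hRg hθ g₀ os hPr => by
      letI : DecidableEq (Σ K, SiteSeqKey F (K₀ + K)) := Classical.decEq _
      obtain ⟨δ₀, ρ, hδ₀, hρs, h0, hTV⟩ := h19 F θ hP hRg hθ g₀ os hPr
      have h := YMDAG.N14.AtSpineReading13CoPH.V.core_crOfRecord₁₃VAt_shellSplitOfRecord_of_coreZero_of_tv θ hP K₀ (jc F θ hP g₀ os) ρA ρB _ hRg.2 (hζm F θ hP hRg hθ)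
        (zeta_nonneg_of_provisos₁₃CoPH F θ hP) g₀ os h0 hδ₀ hTV hρs
      exact ⟨_, h.1, h.2⟩)

/-! ## §3 N19′ in dag-n20-w3's POLICY-FREE LOWERED FIBRE currency (p≈02:21Z `…N20CoreEdgeAtShellSplitOfRecordFibre`: term vs the summed block-down fibre, ANY cut incl. 0) -/

open Classical in
/-- ★★★ **B5 ON THE LIVE LINE OF `G` AT THE v3 PIN WITH THE SHELL SPLIT OF RECORD — N19′ ⟸ dag-n20-w3's LOWERED FIBRE SANDWICH, EVERY CUT POLICY** (X §1 with `h19 :=`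
`core_crOfRecord₁₃VAt_shellSplit_of_loweredFibre_liveSel` per tuple at `jcut := jc F θ hP g₀ os`; no policy letter: the sandwich compares the (2.18) term of a run-A index `s` OFF THE
PERSISTENCE CLASS with the lowered-threshold terms of its whole block-down fibre `{s' | truncSeq s' = s}`, summed; `hU`, `0 ≤ ζ`, `0 < M` supplied from K0c ∕ n20-w2 ∕ `Admissible`).
Displayed N19′ rows: `hR` (flow hypothesis), `hερ` (lowered widths' signs), `h19` (given the rates: a summable `δ` + per `K` one `c` with the fibre sandwich).  NOT PRINTED for
d = 4, NOT proved. [bookkeeping] -/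
theorem spine_rec13CCoPHOn_live_at_shellSplitOfRecord₁₃VAt_cut_of_keyedFacesP_cubeAC_loweredFibre
    (hζm : ∀ (F : T4Family) (θ : Stage13HParams F N), θ.Provisos₁₃CoPH F N →
      (G F θ ∧ θ.ppSel = ppSelLiveOfRecord F N θ.ν θ.τ9 (EOfRecord₁₃ F N θ.toStage13Params) (wOfRecord₉ F N θ.toStage9Params)) → θ.Admissible F N → ZetaMeasurable F N θ.ζ)
    (h20 : ∀ (F : T4Family) (θ : Stage13HParams F N) (hP : θ.Provisos₁₃CoPH F N),
      (G F θ ∧ θ.ppSel = ppSelLiveOfRecord F N θ.ν θ.τ9 (EOfRecord₁₃ F N θ.toStage13Params) (wOfRecord₉ F N θ.toStage9Params)) → θ.Admissible F N →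
        ∀ (g₀ : ℕ → ℝ) (os : List (ULoop F)),
          ∃ W : ℕ → ℝ, RelWeightBound 1 (classSet₁₃ θ K₀ g₀) (weightA₁₃ θ hP K₀ g₀ os) (weightB₁₃ θ hP K₀ g₀ os) (badClass₁₃ θ K₀ g₀ (jc F θ hP g₀ os)) W)
    (hρA : ∀ (F : T4Family) (θ : Stage13HParams F N) (hP : θ.Provisos₁₃CoPH F N),
      (G F θ ∧ θ.ppSel = ppSelLiveOfRecord F N θ.ν θ.τ9 (EOfRecord₁₃ F N θ.toStage13Params) (wOfRecord₉ F N θ.toStage9Params)) → θ.Admissible F N →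
        ∀ (g₀ : ℕ → ℝ) (os : List (ULoop F)) (K : ℕ), 0 ≤ ρA F θ hP g₀ os K)
    (hρB : ∀ (F : T4Family) (θ : Stage13HParams F N) (hP : θ.Provisos₁₃CoPH F N),
      (G F θ ∧ θ.ppSel = ppSelLiveOfRecord F N θ.ν θ.τ9 (EOfRecord₁₃ F N θ.toStage13Params) (wOfRecord₉ F N θ.toStage9Params)) → θ.Admissible F N →
        ∀ (g₀ : ℕ → ℝ) (os : List (ULoop F)) (K : ℕ), 0 ≤ ρB F θ hP g₀ os K)
    (hM1 : ∀ (F : T4Family) (θ : Stage13HParams F N) (hP : θ.Provisos₁₃CoPH F N),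
      (G F θ ∧ θ.ppSel = ppSelLiveOfRecord F N θ.ν θ.τ9 (EOfRecord₁₃ F N θ.toStage13Params) (wOfRecord₉ F N θ.toStage9Params)) → θ.Admissible F N →
        ∀ (g₀ : ℕ → ℝ) (os : List (ULoop F)), ∃ DA DB : ℕ → ℝ, (∀ K, 0 ≤ DA K) ∧ (∀ K, 0 ≤ DB K) ∧
          Summable (fun K => DA K * ρA F θ hP g₀ os K) ∧ Summable (fun K => DB K * ρB F θ hP g₀ os K) ∧
          (∀ (K : ℕ) (t : ℝ), |t| ≤ 1 →
            ∀ a : ↥(cubeIndices (F.P (K₀ + K)) (cubeSide (F.P (K₀ + K)).L θ.ν.M₂ (RkOfRecord (F.P (K₀ + K)).L θ.ν.r (histA₁₃ θ K₀ g₀ K (K₀ + K))) (K₀ + K))),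
              ∑ s, shellPieceOfDatum₉ F N θ.toStage9Params (datumOfRecord₁₃CoPH F N θ hP) g₀ os (runA₁₃ F K₀ g₀ K) (histA₁₃ θ K₀ g₀ K) (K₀ + K)
                  (ρA F θ hP g₀ os K) t a s ≤
                (DA K * ρA F θ hP g₀ os K) *
                  ∑ s, cubeWeightOfDatum₉ F N θ.toStage9Params (datumOfRecord₁₃CoPH F N θ hP) g₀ os (runA₁₃ F K₀ g₀ K) (histA₁₃ θ K₀ g₀ K) (K₀ + K) t a s) ∧
          (∀ (K : ℕ) (t : ℝ), |t| ≤ 1 →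
            ∀ a : ↥(cubeIndices (F.P (K₀ + K + 1)) (cubeSide (F.P (K₀ + K + 1)).L θ.ν.M₂
                (RkOfRecord (F.P (K₀ + K + 1)).L θ.ν.r (histB₁₃ θ K₀ g₀ K (K₀ + K + 1))) (K₀ + K + 1))),
              ∑ s', shellPieceOfDatum₉ F N θ.toStage9Params (datumOfRecord₁₃CoPH F N θ hP) g₀ os (runB₁₃ F K₀ g₀ K) (histB₁₃ θ K₀ g₀ K) (K₀ + K + 1)
                  (ρB F θ hP g₀ os K) t a s' ≤
                (DB K * ρB F θ hP g₀ os K) *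
                  ∑ s', cubeWeightOfDatum₉ F N θ.toStage9Params (datumOfRecord₁₃CoPH F N θ hP) g₀ os (runB₁₃ F K₀ g₀ K) (histB₁₃ θ K₀ g₀ K) (K₀ + K + 1) t a s'))
    (hrates : ∀ (F : T4Family) (θ : Stage13HParams F N) (hP : θ.Provisos₁₃CoPH F N),
      (G F θ ∧ θ.ppSel = ppSelLiveOfRecord F N θ.ν θ.τ9 (EOfRecord₁₃ F N θ.toStage13Params) (wOfRecord₉ F N θ.toStage9Params)) → θ.Admissible F N →
        ∀ (g₀ : ℕ → ℝ) (os : List (ULoop F)), P (datumOfRecord₁₃CoPH F N θ hP) (rr F θ hP g₀ os))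
    (hR : ∀ (F : T4Family) (θ : Stage13HParams F N) (hP : θ.Provisos₁₃CoPH F N), (G F θ ∧ θ.ppSel = ppSelLiveOfRecord F N θ.ν θ.τ9 (EOfRecord₁₃ F N θ.toStage13Params) (wOfRecord₉ F N θ.toStage9Params)) → θ.Admissible F N →
      ∀ (g₀ : ℕ → ℝ) (K : ℕ), RAgree F θ.ν (histA₁₃ θ K₀ g₀ K) (histB₁₃ θ K₀ g₀ K) (K₀ + K))
    (hερ : ∀ (F : T4Family) (θ : Stage13HParams F N) (hP : θ.Provisos₁₃CoPH F N), (G F θ ∧ θ.ppSel = ppSelLiveOfRecord F N θ.ν θ.τ9 (EOfRecord₁₃ F N θ.toStage13Params) (wOfRecord₉ F N θ.toStage9Params)) → θ.Admissible F N →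
      ∀ (g₀ : ℕ → ℝ) (os : List (ULoop F)) (K : ℕ), 0 ≤ epsOfRecord θ.ν (histA₁₃ θ K₀ g₀ K) (K₀ + K) * ρA F θ hP g₀ os K ∧
        0 ≤ epsOfRecord θ.ν (histB₁₃ θ K₀ g₀ K) (K₀ + K + 1) * ρB F θ hP g₀ os K)
    (h19 : ∀ (F : T4Family) (θ : Stage13HParams F N) (hP : θ.Provisos₁₃CoPH F N) (hRg : (G F θ ∧ θ.ppSel = ppSelLiveOfRecord F N θ.ν θ.τ9 (EOfRecord₁₃ F N θ.toStage13Params) (wOfRecord₉ F N θ.toStage9Params))) (hθ : θ.Admissible F N)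
      (g₀ : ℕ → ℝ) (os : List (ULoop F)), P (datumOfRecord₁₃CoPH F N θ hP) (rr F θ hP g₀ os) →
        ∃ δ : ℕ → ℝ, Summable δ ∧ ∀ K : ℕ, ∃ c : ℝ, ∀ t : ℝ, |t| ≤ 1 → ∀ s : SeqOfRecord F θ.ν θ.τ9.M (histA₁₃ θ K₀ g₀ K) (K₀ + K) (K₀ + K),
          (⟨K, twoRunKeyA F θ.ν θ.τ9.M (histA₁₃ θ K₀ g₀ K) (K₀ + K) (K₀ + K) s⟩ : Σ K, SiteSeqKey F (K₀ + K)) ∉ badClass₁₃ θ K₀ g₀ (jc F θ hP g₀ os) K t →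
          Real.exp (c - F.side ^ 4 * δ K) *
                (∫ V, chiSeqOfRecordAt F N θ.ν θ.τ9.M (histA₁₃ θ K₀ g₀ K) (K₀ + K) (K₀ + K)
                        (epsOfRecord θ.ν (histA₁₃ θ K₀ g₀ K) (K₀ + K) * (1 - ρA F θ hP g₀ os K)) s V *
                      dressedSlotsOfDatum₉ F N θ.toStage9Params (datumOfRecord₁₃CoPH F N θ hP) g₀ os t (runA₁₃ F K₀ g₀ K) (histA₁₃ θ K₀ g₀ K) (K₀ + K) s V
                      ∂fieldMeasure (F.P (K₀ + K)) (K₀ + K) (Node00.SU N))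
            ≤ ∑ s' ∈ Finset.univ.filter (fun s' : SeqOfRecord F θ.ν θ.τ9.M (histB₁₃ θ K₀ g₀ K) (K₀ + K + 1) (K₀ + K + 1) => truncSeq F θ.ν hθ.toStage9.2.2.2 (hR F θ hP hRg hθ g₀ K) s' = s),
                (∫ V, chiSeqOfRecordAt F N θ.ν θ.τ9.M (histB₁₃ θ K₀ g₀ K) (K₀ + K + 1) (K₀ + K + 1)
                        (epsOfRecord θ.ν (histB₁₃ θ K₀ g₀ K) (K₀ + K + 1) * (1 - ρB F θ hP g₀ os K)) s' V *
                      dressedSlotsOfDatum₉ F N θ.toStage9Params (datumOfRecord₁₃CoPH F N θ hP) g₀ os t (runB₁₃ F K₀ g₀ K) (histB₁₃ θ K₀ g₀ K) (K₀ + K + 1) s' V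
                      ∂fieldMeasure (F.P (K₀ + K + 1)) (K₀ + K + 1) (Node00.SU N)) ∧
          ∑ s' ∈ Finset.univ.filter (fun s' : SeqOfRecord F θ.ν θ.τ9.M (histB₁₃ θ K₀ g₀ K) (K₀ + K + 1) (K₀ + K + 1) => truncSeq F θ.ν hθ.toStage9.2.2.2 (hR F θ hP hRg hθ g₀ K) s' = s),
                (∫ V, chiSeqOfRecordAt F N θ.ν θ.τ9.M (histB₁₃ θ K₀ g₀ K) (K₀ + K + 1) (K₀ + K + 1)
                        (epsOfRecord θ.ν (histB₁₃ θ K₀ g₀ K) (K₀ + K + 1) * (1 - ρB F θ hP g₀ os K)) s' V *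
                      dressedSlotsOfDatum₉ F N θ.toStage9Params (datumOfRecord₁₃CoPH F N θ hP) g₀ os t (runB₁₃ F K₀ g₀ K) (histB₁₃ θ K₀ g₀ K) (K₀ + K + 1) s' V
                      ∂fieldMeasure (F.P (K₀ + K + 1)) (K₀ + K + 1) (Node00.SU N))
            ≤ Real.exp (c + F.side ^ 4 * δ K) *
                (∫ V, chiSeqOfRecordAt F N θ.ν θ.τ9.M (histA₁₃ θ K₀ g₀ K) (K₀ + K) (K₀ + K)
                        (epsOfRecord θ.ν (histA₁₃ θ K₀ g₀ K) (K₀ + K) * (1 - ρA F θ hP g₀ os K)) s V *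
                      dressedSlotsOfDatum₉ F N θ.toStage9Params (datumOfRecord₁₃CoPH F N θ hP) g₀ os t (runA₁₃ F K₀ g₀ K) (histA₁₃ θ K₀ g₀ K) (K₀ + K) s V
                      ∂fieldMeasure (F.P (K₀ + K)) (K₀ + K) (Node00.SU N))) :
    Spine (N := N) fun F D w => Node00.IsRecordOfRecord₁₃CCoPHOn F N
      (fun F θ => G F θ ∧ θ.ppSel = ppSelLiveOfRecord F N θ.ν θ.τ9 (EOfRecord₁₃ F N θ.toStage13Params) (wOfRecord₉ F N θ.toStage9Params)) D w :=
  spine_rec13CCoPHOn_live_at_shellSplitOfRecord₁₃VAt_cut_of_keyedFacesP_cubeAC K₀ jc ρA ρB G rr P hζm h20 hρA hρB hM1 hrates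
    (fun F θ hP hRg hθ g₀ os hPr => by
      letI : DecidableEq (Σ K, SiteSeqKey F (K₀ + K)) := Classical.decEq _
      obtain ⟨δ, hδ, hlow⟩ := h19 F θ hP hRg hθ g₀ os hPr
      exact ⟨_, core_crOfRecord₁₃VAt_shellSplit_of_loweredFibre_liveSel θ hP K₀ g₀ os hθ.toStage9.2.2.2 (hR F θ hP hRg hθ g₀) (jc F θ hP g₀ os) ρA ρB hδ _ hRg.2
        (localBgMeasurable F N θ.ν) (hζm F θ hP hRg hθ) (fun K => (hερ F θ hP hRg hθ g₀ os K).1) (fun K => (hερ F θ hP hRg hθ g₀ os K).2) hlow⟩)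

/-! ## §4 THE ZERO CUT with the shell split of record: N20 DISCHARGED (dag-n20-w2), N21 ⟸ (M1), N19′ ⟸ the fibre sandwich on EVERY key — the cheapest HONEST dial -/

open Classical in
/-- ★★★ **B5 ON THE LIVE LINE OF `G` AT `(jc, sh) = (0, shellSplitOfRecord₁₃At N K₀ ρA ρB)` WITH EVERY REMAINING K5 SLOT IN PRODUCER CURRENCY** — N20 DISCHARGED (dag-n20-w2
`relWeightBound_carriers₁₃_cutZero`), N21 ⟸ dag-n21-d's (M1) rows, N19′ ⟸ dag-n20-w3's lowered FIBRE sandwich whose persistence premise is VACUOUS at the zero cut (`badClass₁₃ … (fun _ ↦ 0)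
= ∅`): B5 from EXACTLY `hζm`, the width∕lowered-width signs, the (M1) data, the rates, the flow hypothesis `hR`, and the fibre sandwich on EVERY run-A index — the located answer to «the
term road needs `1 ≤ jc`» (§1): with the fibre edition the two cheapest settings DO combine.  NOT PRINTED for d = 4, NOT proved; the dial books nothing for N20. [bookkeeping] -/
theorem spine_rec13CCoPHOn_live_at_shellSplitOfRecord₁₃VAt_cut_of_keyedFacesP_cutZero_cubeAC_loweredFibre
    (hζm : ∀ (F : T4Family) (θ : Stage13HParams F N), θ.Provisos₁₃CoPH F N →
      (G F θ ∧ θ.ppSel = ppSelLiveOfRecord F N θ.ν θ.τ9 (EOfRecord₁₃ F N θ.toStage13Params) (wOfRecord₉ F N θ.toStage9Params)) → θ.Admissible F N → ZetaMeasurable F N θ.ζ)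
    (hρA : ∀ (F : T4Family) (θ : Stage13HParams F N) (hP : θ.Provisos₁₃CoPH F N),
      (G F θ ∧ θ.ppSel = ppSelLiveOfRecord F N θ.ν θ.τ9 (EOfRecord₁₃ F N θ.toStage13Params) (wOfRecord₉ F N θ.toStage9Params)) → θ.Admissible F N →
        ∀ (g₀ : ℕ → ℝ) (os : List (ULoop F)) (K : ℕ), 0 ≤ ρA F θ hP g₀ os K)
    (hρB : ∀ (F : T4Family) (θ : Stage13HParams F N) (hP : θ.Provisos₁₃CoPH F N),
      (G F θ ∧ θ.ppSel = ppSelLiveOfRecord F N θ.ν θ.τ9 (EOfRecord₁₃ F N θ.toStage13Params) (wOfRecord₉ F N θ.toStage9Params)) → θ.Admissible F N →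
        ∀ (g₀ : ℕ → ℝ) (os : List (ULoop F)) (K : ℕ), 0 ≤ ρB F θ hP g₀ os K)
    (hM1 : ∀ (F : T4Family) (θ : Stage13HParams F N) (hP : θ.Provisos₁₃CoPH F N),
      (G F θ ∧ θ.ppSel = ppSelLiveOfRecord F N θ.ν θ.τ9 (EOfRecord₁₃ F N θ.toStage13Params) (wOfRecord₉ F N θ.toStage9Params)) → θ.Admissible F N →
        ∀ (g₀ : ℕ → ℝ) (os : List (ULoop F)), ∃ DA DB : ℕ → ℝ, (∀ K, 0 ≤ DA K) ∧ (∀ K, 0 ≤ DB K) ∧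
          Summable (fun K => DA K * ρA F θ hP g₀ os K) ∧ Summable (fun K => DB K * ρB F θ hP g₀ os K) ∧
          (∀ (K : ℕ) (t : ℝ), |t| ≤ 1 →
            ∀ a : ↥(cubeIndices (F.P (K₀ + K)) (cubeSide (F.P (K₀ + K)).L θ.ν.M₂ (RkOfRecord (F.P (K₀ + K)).L θ.ν.r (histA₁₃ θ K₀ g₀ K (K₀ + K))) (K₀ + K))),
              ∑ s, shellPieceOfDatum₉ F N θ.toStage9Params (datumOfRecord₁₃CoPH F N θ hP) g₀ os (runA₁₃ F K₀ g₀ K) (histA₁₃ θ K₀ g₀ K) (K₀ + K)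
                  (ρA F θ hP g₀ os K) t a s ≤
                (DA K * ρA F θ hP g₀ os K) *
                  ∑ s, cubeWeightOfDatum₉ F N θ.toStage9Params (datumOfRecord₁₃CoPH F N θ hP) g₀ os (runA₁₃ F K₀ g₀ K) (histA₁₃ θ K₀ g₀ K) (K₀ + K) t a s) ∧
          (∀ (K : ℕ) (t : ℝ), |t| ≤ 1 →
            ∀ a : ↥(cubeIndices (F.P (K₀ + K + 1)) (cubeSide (F.P (K₀ + K + 1)).L θ.ν.M₂
                (RkOfRecord (F.P (K₀ + K + 1)).L θ.ν.r (histB₁₃ θ K₀ g₀ K (K₀ + K + 1))) (K₀ + K + 1))),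
              ∑ s', shellPieceOfDatum₉ F N θ.toStage9Params (datumOfRecord₁₃CoPH F N θ hP) g₀ os (runB₁₃ F K₀ g₀ K) (histB₁₃ θ K₀ g₀ K) (K₀ + K + 1)
                  (ρB F θ hP g₀ os K) t a s' ≤
                (DB K * ρB F θ hP g₀ os K) *
                  ∑ s', cubeWeightOfDatum₉ F N θ.toStage9Params (datumOfRecord₁₃CoPH F N θ hP) g₀ os (runB₁₃ F K₀ g₀ K) (histB₁₃ θ K₀ g₀ K) (K₀ + K + 1) t a s'))
    (hrates : ∀ (F : T4Family) (θ : Stage13HParams F N) (hP : θ.Provisos₁₃CoPH F N),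
      (G F θ ∧ θ.ppSel = ppSelLiveOfRecord F N θ.ν θ.τ9 (EOfRecord₁₃ F N θ.toStage13Params) (wOfRecord₉ F N θ.toStage9Params)) → θ.Admissible F N →
        ∀ (g₀ : ℕ → ℝ) (os : List (ULoop F)), P (datumOfRecord₁₃CoPH F N θ hP) (rr F θ hP g₀ os))
    (hR : ∀ (F : T4Family) (θ : Stage13HParams F N) (hP : θ.Provisos₁₃CoPH F N), (G F θ ∧ θ.ppSel = ppSelLiveOfRecord F N θ.ν θ.τ9 (EOfRecord₁₃ F N θ.toStage13Params) (wOfRecord₉ F N θ.toStage9Params)) → θ.Admissible F N →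
      ∀ (g₀ : ℕ → ℝ) (K : ℕ), RAgree F θ.ν (histA₁₃ θ K₀ g₀ K) (histB₁₃ θ K₀ g₀ K) (K₀ + K))
    (hερ : ∀ (F : T4Family) (θ : Stage13HParams F N) (hP : θ.Provisos₁₃CoPH F N), (G F θ ∧ θ.ppSel = ppSelLiveOfRecord F N θ.ν θ.τ9 (EOfRecord₁₃ F N θ.toStage13Params) (wOfRecord₉ F N θ.toStage9Params)) → θ.Admissible F N →
      ∀ (g₀ : ℕ → ℝ) (os : List (ULoop F)) (K : ℕ), 0 ≤ epsOfRecord θ.ν (histA₁₃ θ K₀ g₀ K) (K₀ + K) * ρA F θ hP g₀ os K ∧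
        0 ≤ epsOfRecord θ.ν (histB₁₃ θ K₀ g₀ K) (K₀ + K + 1) * ρB F θ hP g₀ os K)
    (h19 : ∀ (F : T4Family) (θ : Stage13HParams F N) (hP : θ.Provisos₁₃CoPH F N) (hRg : (G F θ ∧ θ.ppSel = ppSelLiveOfRecord F N θ.ν θ.τ9 (EOfRecord₁₃ F N θ.toStage13Params) (wOfRecord₉ F N θ.toStage9Params))) (hθ : θ.Admissible F N)
      (g₀ : ℕ → ℝ) (os : List (ULoop F)), P (datumOfRecord₁₃CoPH F N θ hP) (rr F θ hP g₀ os) →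
        ∃ δ : ℕ → ℝ, Summable δ ∧ ∀ K : ℕ, ∃ c : ℝ, ∀ t : ℝ, |t| ≤ 1 → ∀ s : SeqOfRecord F θ.ν θ.τ9.M (histA₁₃ θ K₀ g₀ K) (K₀ + K) (K₀ + K),
          (⟨K, twoRunKeyA F θ.ν θ.τ9.M (histA₁₃ θ K₀ g₀ K) (K₀ + K) (K₀ + K) s⟩ : Σ K, SiteSeqKey F (K₀ + K)) ∉ badClass₁₃ θ K₀ g₀ (fun _ => 0) K t →
          Real.exp (c - F.side ^ 4 * δ K) *
                (∫ V, chiSeqOfRecordAt F N θ.ν θ.τ9.M (histA₁₃ θ K₀ g₀ K) (K₀ + K) (K₀ + K)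
                        (epsOfRecord θ.ν (histA₁₃ θ K₀ g₀ K) (K₀ + K) * (1 - ρA F θ hP g₀ os K)) s V *
                      dressedSlotsOfDatum₉ F N θ.toStage9Params (datumOfRecord₁₃CoPH F N θ hP) g₀ os t (runA₁₃ F K₀ g₀ K) (histA₁₃ θ K₀ g₀ K) (K₀ + K) s V
                      ∂fieldMeasure (F.P (K₀ + K)) (K₀ + K) (Node00.SU N))
            ≤ ∑ s' ∈ Finset.univ.filter (fun s' : SeqOfRecord F θ.ν θ.τ9.M (histB₁₃ θ K₀ g₀ K) (K₀ + K + 1) (K₀ + K + 1) => truncSeq F θ.ν hθ.toStage9.2.2.2 (hR F θ hP hRg hθ g₀ K) s' = s),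
                (∫ V, chiSeqOfRecordAt F N θ.ν θ.τ9.M (histB₁₃ θ K₀ g₀ K) (K₀ + K + 1) (K₀ + K + 1)
                        (epsOfRecord θ.ν (histB₁₃ θ K₀ g₀ K) (K₀ + K + 1) * (1 - ρB F θ hP g₀ os K)) s' V *
                      dressedSlotsOfDatum₉ F N θ.toStage9Params (datumOfRecord₁₃CoPH F N θ hP) g₀ os t (runB₁₃ F K₀ g₀ K) (histB₁₃ θ K₀ g₀ K) (K₀ + K + 1) s' V
                      ∂fieldMeasure (F.P (K₀ + K + 1)) (K₀ + K + 1) (Node00.SU N)) ∧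
          ∑ s' ∈ Finset.univ.filter (fun s' : SeqOfRecord F θ.ν θ.τ9.M (histB₁₃ θ K₀ g₀ K) (K₀ + K + 1) (K₀ + K + 1) => truncSeq F θ.ν hθ.toStage9.2.2.2 (hR F θ hP hRg hθ g₀ K) s' = s),
                (∫ V, chiSeqOfRecordAt F N θ.ν θ.τ9.M (histB₁₃ θ K₀ g₀ K) (K₀ + K + 1) (K₀ + K + 1)
                        (epsOfRecord θ.ν (histB₁₃ θ K₀ g₀ K) (K₀ + K + 1) * (1 - ρB F θ hP g₀ os K)) s' V *
                      dressedSlotsOfDatum₉ F N θ.toStage9Params (datumOfRecord₁₃CoPH F N θ hP) g₀ os t (runB₁₃ F K₀ g₀ K) (histB₁₃ θ K₀ g₀ K) (K₀ + K + 1) s' V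
                      ∂fieldMeasure (F.P (K₀ + K + 1)) (K₀ + K + 1) (Node00.SU N))
            ≤ Real.exp (c + F.side ^ 4 * δ K) *
                (∫ V, chiSeqOfRecordAt F N θ.ν θ.τ9.M (histA₁₃ θ K₀ g₀ K) (K₀ + K) (K₀ + K)
                        (epsOfRecord θ.ν (histA₁₃ θ K₀ g₀ K) (K₀ + K) * (1 - ρA F θ hP g₀ os K)) s V *
                      dressedSlotsOfDatum₉ F N θ.toStage9Params (datumOfRecord₁₃CoPH F N θ hP) g₀ os t (runA₁₃ F K₀ g₀ K) (histA₁₃ θ K₀ g₀ K) (K₀ + K) s V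
                      ∂fieldMeasure (F.P (K₀ + K)) (K₀ + K) (Node00.SU N))) :
    Spine (N := N) fun F D w => Node00.IsRecordOfRecord₁₃CCoPHOn F N
      (fun F θ => G F θ ∧ θ.ppSel = ppSelLiveOfRecord F N θ.ν θ.τ9 (EOfRecord₁₃ F N θ.toStage13Params) (wOfRecord₉ F N θ.toStage9Params)) D w :=
  spine_rec13CCoPHOn_live_at_shellSplitOfRecord₁₃VAt_cut_of_keyedFacesP_cubeAC_loweredFibre K₀ (fun _ _ _ _ _ _ => 0) ρA ρB G rr P hζm
    (fun F θ hP _ _ g₀ os => ⟨_, relWeightBound_carriers₁₃_cutZero F θ hP K₀ g₀ os⟩) hρA hρB hM1 hrates hR hερ h19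

end Summit.QuantumFields.YangMills.Theorems.BalabanUVNodesN27SpineRecord

end
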